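/-
COR-CM (cell pub-hodgecm2, stage 2 of the Hodge ladder) — count-neutral KERNEL CENSUS TRANSPORT, INTRINSIC FORM, abelian non-cyclic
octic types (seat prover-pub-hodgecm2-b23-g33-0, binder prover b23, gen 33; claim INT2-INTRINSIC, HOME/lit/LIT-STATUS.md 2026-08-21T18:02Z;
sequel of `Census/OcticFaceTransportAbelian.lean` and `CorCM/FaceCensusGroupDictionary.lean`).
Theorems only; no definition, no named fact, nothing asserted; seat b30's census dictionaries (`enum`, `table_spec`/`group_spec`,
`conj_spec`) are consumed BY NAME; `Interfaces.lean` (C1), every E term, B01 and `Transposition/*` are untouched. HONEST FRAMING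
(COORDINATOR RULING — HODGE FRAMING CORRECTION, 2026-08-21T11:55:35Z): `HC_CM` is NOT proved, here or anywhere in the tree. Every closing
theorem below is CONDITIONAL on face-period witnesses (for ONE field, on the listed faces); no period is proved here.
T5 (coordinator ruling 15:33:56Z (3), lead staging l.4095): the DICTIONARY binders of the census transport (`ε`, `hε`, `c`, `hc`, `ε c = Γ.conj`
of the `…_aut` theorems) are DISCHARGED here from an isomorphism `e : Gal(K/ℚ) ≃* Multiplicative (ZMod 4 × ZMod 2)` resp.
`Multiplicative (ZMod 2 × ZMod 2 × ZMod 2)` together with the NAME of complex conjugation in it (`e⁻¹(2,0)` / `e⁻¹(0,1)` / `e⁻¹(1,0,0)`), and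
§4 proves that such a normalised `e` exists for every field of the type (`conj_dichotomy_of_mulEquiv_zmod_four_two`,
`exists_mulEquiv_conj_zmod_two_cube`) — jointly inhabited; the face-reading binders are inhabited in the kernel (`exists_faceᵢ_of_mulEquiv`);
the only remaining hypotheses are the period witnesses on the listed faces = instances of the crux (`FacePeriodExists` / B01-S), against which
the tree has no `¬` theorem on the universe of record — no contradiction derivable; checker: self (prover-pub-hodgecm2-b23-g33-0),
2026-08-21T19:10Z.
-/
import Summits.HodgeConjecture.CorCM.FaceCensusGroupDictionary
import Summits.HodgeConjecture.CorCM.Census.OcticFaceTransportAbelian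
import HarnessLib

/-!
# Galois CM fields with group `ℤ/4×ℤ/2`: field closure from an isomorphism with the Mathlib group (intrinsic form); normalisations

The automorphism-form field-closure theorems `…_octicC4C2Square_aut`, `…_octicC4C2Nonsquare_aut` (this file) and
`…_octicTriquadratic_aut` (sequel `Census/OcticFaceTransportIntrinsicTriquadratic.lean`) of the census transport take an enumeration `ε : Aut(K) ≃ Fin 8` multiplicative for seat b30's Cayley table, the conjugation automorphism `c`
at `σ₀` and `ε c = Γ.conj` as hypotheses.  Here all of it is derived from ONE isomorphism `e : Gal(K/ℚ) ≃* Multiplicative V`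
(`V = ZMod 4 × ZMod 2` resp. `ZMod 2 × ZMod 2 × ZMod 2`) together with the NAME of complex conjugation in `V`: `ε := enum⁻¹ ∘ toAdd ∘ e`
(`FaceCensus.exists_enum_of_groupEnum` over b30's certified additive dictionary).  In an abelian group with several involutions the
position of complex conjugation is genuine data — it separates b30's two `ℤ/4×ℤ/2` census types: `c` a square (`c ↦ (2,0)`) or not
(`c ↦ (0,1)` after normalisation) — and §4 shows that every isomorphism can be normalised accordingly
(`FaceCensus.conj_dichotomy_of_mulEquiv_zmod_four_two`, `FaceCensus.exists_mulEquiv_conj_zmod_two_cube`).  The generating faces of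
b30's census then read as explicit group data (base type `Φ₀`, place representatives `σ₀` and `σ₀ ∘ e⁻¹(x)`):

* `ℤ/4×ℤ/2`, `c ↦ (2,0)`: `Φ₀ ↔ {(0,0),(1,0),(0,1),(1,1)}`; TWO faces `(Φ₀; σ₀, σ₀∘e⁻¹(1,0))`, `(Φ₀; σ₀, σ₀∘e⁻¹(0,1))`;
* `ℤ/4×ℤ/2`, `c ↦ (0,1)`: `Φ₀ ↔ {(0,0),(1,0),(2,0),(3,0)}`; TWO faces `(Φ₀; σ₀, σ₀∘e⁻¹(1,0))`, `(Φ₀; σ₀, σ₀∘e⁻¹(2,0))`;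
* `(ℤ/2)³`, `c ↦ (1,0,0)` (sequel file): THREE faces.

Such faces exist for every admissible `K`, `e`, `σ₀` (`exists_faceᵢ_of_mulEquiv`), and ONE period witness per face on the universe of record
gives the Hodge conjecture for every complex abelian variety dominated by a product of CM abelian varieties with CM by subfields of `K`
(`…_mulEquiv`).  `HC_CM` is NOT proved and nothing here produces a period.

References: [cite: Pohlmann1968, Thm. 1]; [cite: Milne1999LefschetzClasses, Thm. 3.2 and Cor. 4.5];
[cite: Shimura1998, §6.2 Theorem 3 and §6.1 Corollary of Theorem 2 (pp. 41–43)]; [cite: MumfordAV1970, §19 Thm. 1 and p. 169].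
-/

noncomputable section

open CategoryTheory NumberField NumberField.ComplexEmbedding
open Literature.AlgebraicGeometry Literature.AlgebraicGeometry.Motives Literature.AlgebraicGeometry.HodgeTheory
open Literature.AlgebraicGeometry.ComplexMultiplication Literature.AlgebraicGeometry.Milne1999
open Literature.NumberTheory.Automorphic
open Literature.NumberTheory.Automorphic.PicardCM
open Summit.HodgeConjecture.CorCM.Domination

namespace Summit.HodgeConjecture.CorCM.OcticFaceTransport.C4C2Square

open Summit.HodgeConjecture.CorCM.Census.FaceSquaresModel (mem)
open Summit.HodgeConjecture.CorCM.Census.OcticFaceSquaresC4C2Square (Γ enum table_spec conj_spec)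

/-- **The dictionary from an isomorphism with `ZMod 4 × ZMod 2`, type `ℤ/4×ℤ/2, c a square`.**  `K` a Galois CM field,
`e : Gal(K/ℚ) ≃* Multiplicative (ZMod 4 × ZMod 2)` such that `e⁻¹(2,0)` induces complex conjugation at `σ₀` (the SQUARE class, `FaceCensus.conj_dichotomy_of_mulEquiv_zmod_four_two` §4).  Then there is an enumeration `ε : Aut(K) ≃ Fin 8`,
multiplicative for seat b30's Cayley table, reading `e` through b30's additive `enum` (`enum (ε h) = toAdd (e h)`), with
`ε (e⁻¹ conj-element) = Γ.conj`. [folklore] -/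
theorem exists_autEnum_of_mulEquiv (K : CMField) [IsGalois ℚ K] (e : ((K : Type) ≃ₐ[ℚ] (K : Type)) ≃* Multiplicative (ZMod 4 × ZMod 2)) :
    ∃ ε : ((K : Type) ≃ₐ[ℚ] (K : Type)) ≃ Fin 8,
      (∀ x y : ((K : Type) ≃ₐ[ℚ] (K : Type)), ε (x * y) = Γ.mul (ε x) (ε y)) ∧ (∀ h : ((K : Type) ≃ₐ[ℚ] (K : Type)), enum (ε h) = Multiplicative.toAdd (e h)) ∧
      (∀ (h : ((K : Type) ≃ₐ[ℚ] (K : Type))) (i : Fin 8), Multiplicative.toAdd (e h) = enum i → ε h = i) ∧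
      ε (e.symm (Multiplicative.ofAdd ((2 : ZMod 4), (0 : ZMod 2)))) = Γ.conj := by
  obtain ⟨ε, hε, hread⟩ := FaceCensus.exists_enum_of_groupEnum Γ (· + ·) enum table_spec.1 table_spec.2
    (by simp) (fun h => Multiplicative.toAdd (e h)) (Multiplicative.toAdd.bijective.comp e.bijective)
    (fun x y => by rw [map_mul, toAdd_mul])
  refine ⟨ε, hε, hread, fun h i hh => table_spec.2 ((hread h).trans hh), table_spec.2 ?_⟩
  rw [hread, MulEquiv.apply_symm_apply, toAdd_ofAdd, conj_spec]

/-- The common base type of the generating representatives, code `51`, read in `ZMod 4 × ZMod 2`. [folklore] -/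
theorem mem_51_iff_enum : ∀ i : Fin 8, mem i 51 = true ↔ enum i ∈ ({((0 : ZMod 4), (0 : ZMod 2)), ((1 : ZMod 4), (0 : ZMod 2)), ((0 : ZMod 4), (1 : ZMod 2)), ((1 : ZMod 4), (1 : ZMod 2))} : Finset (ZMod 4 × ZMod 2)) := by
  decide

/-- **Non-vacuity, type `ℤ/4×ℤ/2, c a square`, face 1.**  For `K`, `e`, `σ₀` as in the closing theorem there is a rank-four face
`(Φ₀; σ₀, σ₀ ∘ e⁻¹(1,0))`: base type `Φ₀` with `σ₀ ∘ h ∈ Φ₀ ↔ e h ∈ {(0,0),(1,0),(0,1),(1,1)}`, place representatives `σ₀` and `σ₀ ∘ e⁻¹((1), (0))`.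
[folklore] -/
theorem exists_face₁_of_mulEquiv (K : CMField) [IsGalois ℚ K] (e : ((K : Type) ≃ₐ[ℚ] (K : Type)) ≃* Multiplicative (ZMod 4 × ZMod 2)) (σ₀ : (K : Type) →+* ℂ)
    (hconj : σ₀.comp ((e.symm (Multiplicative.ofAdd ((2 : ZMod 4), (0 : ZMod 2))) : ((K : Type) ≃ₐ[ℚ] (K : Type))) : (K : Type) →+* (K : Type)) = conjugate σ₀) :
    ∃ R : Face K, (∀ h : ((K : Type) ≃ₐ[ℚ] (K : Type)), σ₀.comp (h : (K : Type) →+* (K : Type)) ∈ R.Φ.1 ↔ Multiplicative.toAdd (e h) ∈ ({((0 : ZMod 4), (0 : ZMod 2)), ((1 : ZMod 4), (0 : ZMod 2)), ((0 : ZMod 4), (1 : ZMod 2)), ((1 : ZMod 4), (1 : ZMod 2))} : Finset (ZMod 4 × ZMod 2))) ∧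
      R.p = σ₀ ∧ R.p' = σ₀.comp ((e.symm (Multiplicative.ofAdd ((1 : ZMod 4), (0 : ZMod 2))) : ((K : Type) ≃ₐ[ℚ] (K : Type))) : (K : Type) →+* (K : Type)) := by
  obtain ⟨ε, hε, hread, hidx, hεc⟩ := exists_autEnum_of_mulEquiv K e
  obtain ⟨e', hmul, he⟩ := FaceCensus.exists_enum_of_autEnum Γ σ₀ ε hε
  have hconj' : e' conjT = Γ.conj := by rw [FaceCensus.conjT_eq_translate σ₀, ← hconj, he, hεc]
  obtain ⟨R₀, hT₀, -, -⟩ := FaceCensus.exists_face_reads Γ e' hmul hconj' σ₀ (r := (51, 5, 10)) (by decide +kernel)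
  have hq : ε (e.symm (Multiplicative.ofAdd ((1 : ZMod 4), (0 : ZMod 2)))) = 1 :=
    hidx _ _ (by rw [MulEquiv.apply_symm_apply, toAdd_ofAdd]; decide)
  have h1 : ε 1 = 0 := hidx _ _ (by rw [map_one, toAdd_one]; decide)
  have hne' : InfinitePlace.mk (σ₀.comp ((1 : ((K : Type) ≃ₐ[ℚ] (K : Type))) : (K : Type) →+* (K : Type))) ≠
      InfinitePlace.mk (σ₀.comp ((e.symm (Multiplicative.ofAdd ((1 : ZMod 4), (0 : ZMod 2))) : ((K : Type) ≃ₐ[ℚ] (K : Type))) : (K : Type) →+* (K : Type))) := by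
    rw [Ne, FaceCensus.mk_comp_eq_mk_comp_iff σ₀ hconj]
    rintro (h | h)
    · have := congrArg ε h; rw [h1, hq] at this; exact absurd this (by decide)
    · have := congrArg ε h; rw [mul_one, hεc, hq] at this; exact absurd this (by decide)
  have hne : InfinitePlace.mk σ₀ ≠ InfinitePlace.mk (σ₀.comp ((e.symm (Multiplicative.ofAdd ((1 : ZMod 4), (0 : ZMod 2))) : ((K : Type) ≃ₐ[ℚ] (K : Type))) : (K : Type) →+* (K : Type))) := by
    rwa [FaceCensus.comp_coe_one] at hne'
  refine ⟨⟨R₀.Φ, _, _, hne⟩, fun h => ?_, rfl, rfl⟩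
  have hk := hT₀.2 (e' (translate σ₀ (σ₀.comp (h : (K : Type) →+* (K : Type)))))
  rw [e'.symm_apply_apply, mem_pullType, translate_apply_self, he] at hk
  rw [← hread h]
  exact hk.symm.trans (mem_51_iff_enum (ε h))

/-- **Non-vacuity, type `ℤ/4×ℤ/2, c a square`, face 2.**  For `K`, `e`, `σ₀` as in the closing theorem there is a rank-four face
`(Φ₀; σ₀, σ₀ ∘ e⁻¹(0,1))`: base type `Φ₀` with `σ₀ ∘ h ∈ Φ₀ ↔ e h ∈ {(0,0),(1,0),(0,1),(1,1)}`, place representatives `σ₀` and `σ₀ ∘ e⁻¹((0), (1))`.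
[folklore] -/
theorem exists_face₂_of_mulEquiv (K : CMField) [IsGalois ℚ K] (e : ((K : Type) ≃ₐ[ℚ] (K : Type)) ≃* Multiplicative (ZMod 4 × ZMod 2)) (σ₀ : (K : Type) →+* ℂ)
    (hconj : σ₀.comp ((e.symm (Multiplicative.ofAdd ((2 : ZMod 4), (0 : ZMod 2))) : ((K : Type) ≃ₐ[ℚ] (K : Type))) : (K : Type) →+* (K : Type)) = conjugate σ₀) :
    ∃ R : Face K, (∀ h : ((K : Type) ≃ₐ[ℚ] (K : Type)), σ₀.comp (h : (K : Type) →+* (K : Type)) ∈ R.Φ.1 ↔ Multiplicative.toAdd (e h) ∈ ({((0 : ZMod 4), (0 : ZMod 2)), ((1 : ZMod 4), (0 : ZMod 2)), ((0 : ZMod 4), (1 : ZMod 2)), ((1 : ZMod 4), (1 : ZMod 2))} : Finset (ZMod 4 × ZMod 2))) ∧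
      R.p = σ₀ ∧ R.p' = σ₀.comp ((e.symm (Multiplicative.ofAdd ((0 : ZMod 4), (1 : ZMod 2))) : ((K : Type) ≃ₐ[ℚ] (K : Type))) : (K : Type) →+* (K : Type)) := by
  obtain ⟨ε, hε, hread, hidx, hεc⟩ := exists_autEnum_of_mulEquiv K e
  obtain ⟨e', hmul, he⟩ := FaceCensus.exists_enum_of_autEnum Γ σ₀ ε hε
  have hconj' : e' conjT = Γ.conj := by rw [FaceCensus.conjT_eq_translate σ₀, ← hconj, he, hεc]
  obtain ⟨R₀, hT₀, -, -⟩ := FaceCensus.exists_face_reads Γ e' hmul hconj' σ₀ (r := (51, 5, 80)) (by decide +kernel)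
  have hq : ε (e.symm (Multiplicative.ofAdd ((0 : ZMod 4), (1 : ZMod 2)))) = 4 :=
    hidx _ _ (by rw [MulEquiv.apply_symm_apply, toAdd_ofAdd]; decide)
  have h1 : ε 1 = 0 := hidx _ _ (by rw [map_one, toAdd_one]; decide)
  have hne' : InfinitePlace.mk (σ₀.comp ((1 : ((K : Type) ≃ₐ[ℚ] (K : Type))) : (K : Type) →+* (K : Type))) ≠
      InfinitePlace.mk (σ₀.comp ((e.symm (Multiplicative.ofAdd ((0 : ZMod 4), (1 : ZMod 2))) : ((K : Type) ≃ₐ[ℚ] (K : Type))) : (K : Type) →+* (K : Type))) := by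
    rw [Ne, FaceCensus.mk_comp_eq_mk_comp_iff σ₀ hconj]
    rintro (h | h)
    · have := congrArg ε h; rw [h1, hq] at this; exact absurd this (by decide)
    · have := congrArg ε h; rw [mul_one, hεc, hq] at this; exact absurd this (by decide)
  have hne : InfinitePlace.mk σ₀ ≠ InfinitePlace.mk (σ₀.comp ((e.symm (Multiplicative.ofAdd ((0 : ZMod 4), (1 : ZMod 2))) : ((K : Type) ≃ₐ[ℚ] (K : Type))) : (K : Type) →+* (K : Type))) := by
    rwa [FaceCensus.comp_coe_one] at hne'
  refine ⟨⟨R₀.Φ, _, _, hne⟩, fun h => ?_, rfl, rfl⟩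
  have hk := hT₀.2 (e' (translate σ₀ (σ₀.comp (h : (K : Type) →+* (K : Type)))))
  rw [e'.symm_apply_apply, mem_pullType, translate_apply_self, he] at hk
  rw [← hread h]
  exact hk.symm.trans (mem_51_iff_enum (ε h))

/-- **FIELD CLOSURE FROM `Gal(K/ℚ) ≃* Multiplicative (ZMod 4 × ZMod 2)`, type `ℤ/4×ℤ/2, c a square` — CLOSED, headline.**  `K` a Galois CM
field with an isomorphism `e : Gal(K/ℚ) ≃* Multiplicative (ZMod 4 × ZMod 2)` (so `[K:ℚ] = 8`) under which `e⁻¹(2,0)` induces complex conjugation at `σ₀` (the SQUARE class, `FaceCensus.conj_dichotomy_of_mulEquiv_zmod_four_two` §4); `σ₀` a base embedding;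
`Φ₀` the CM type with `σ₀ ∘ h ∈ Φ₀ ↔ e h ∈ {(0,0),(1,0),(0,1),(1,1)}`; the TWO faces `R₁ = (Φ₀; σ₀, σ₀ ∘ e⁻¹(1,0))`, `R₂ = (Φ₀; σ₀, σ₀ ∘ e⁻¹(0,1))`
(they exist: `exists_face₁_of_mulEquiv`, `exists_face₂_of_mulEquiv`).  ONE period witness for each on the universe of record implies the Hodge conjecture, in every
codimension, for every complex abelian variety dominated by a finite product of abelian varieties realising CM types of CM fields
embeddable in `K`.  No enumeration or table hypothesis is left (`exists_autEnum_of_mulEquiv`).  (FRAMING: conditional on these face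
periods; `HC_CM` is NOT proved.) [cite: Shimura1998, §6.2 Theorem 3 and §6.1 Corollary of Theorem 2 (pp. 41–43)]
[cite: Pohlmann1968, Thm. 1] [cite: Milne1999LefschetzClasses, Thm. 3.2 and Cor. 4.5] [cite: MumfordAV1970, §19 Thm. 1 and p. 169] -/
theorem hodgeConjectureFor_of_avDominatedBy_isProductOf_of_facePeriod_octicC4C2Square_mulEquiv (K : CMField) [IsGalois ℚ K]
    (e : ((K : Type) ≃ₐ[ℚ] (K : Type)) ≃* Multiplicative (ZMod 4 × ZMod 2)) (σ₀ : (K : Type) →+* ℂ)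
    (hconj : σ₀.comp ((e.symm (Multiplicative.ofAdd ((2 : ZMod 4), (0 : ZMod 2))) : ((K : Type) ≃ₐ[ℚ] (K : Type))) : (K : Type) →+* (K : Type)) = conjugate σ₀)
    (R₁ R₂ : Face K)
    (hΦ₁ : ∀ h : ((K : Type) ≃ₐ[ℚ] (K : Type)), σ₀.comp (h : (K : Type) →+* (K : Type)) ∈ R₁.Φ.1 ↔ Multiplicative.toAdd (e h) ∈ ({((0 : ZMod 4), (0 : ZMod 2)), ((1 : ZMod 4), (0 : ZMod 2)), ((0 : ZMod 4), (1 : ZMod 2)), ((1 : ZMod 4), (1 : ZMod 2))} : Finset (ZMod 4 × ZMod 2)))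
    (hp₁ : R₁.p = σ₀) (hq₁ : R₁.p' = σ₀.comp ((e.symm (Multiplicative.ofAdd ((1 : ZMod 4), (0 : ZMod 2))) : ((K : Type) ≃ₐ[ℚ] (K : Type))) : (K : Type) →+* (K : Type)))
    (hΦ₂ : ∀ h : ((K : Type) ≃ₐ[ℚ] (K : Type)), σ₀.comp (h : (K : Type) →+* (K : Type)) ∈ R₂.Φ.1 ↔ Multiplicative.toAdd (e h) ∈ ({((0 : ZMod 4), (0 : ZMod 2)), ((1 : ZMod 4), (0 : ZMod 2)), ((0 : ZMod 4), (1 : ZMod 2)), ((1 : ZMod 4), (1 : ZMod 2))} : Finset (ZMod 4 × ZMod 2)))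
    (hp₂ : R₂.p = σ₀) (hq₂ : R₂.p' = σ₀.comp ((e.symm (Multiplicative.ofAdd ((0 : ZMod 4), (1 : ZMod 2))) : ((K : Type) ≃ₐ[ℚ] (K : Type))) : (K : Type) →+* (K : Type)))
    (h₁ : ∃ ι₁ : K →+* ℂ, R₁.Admissible ι₁ ∧ ∃ (V : HermSpace3 K ι₁) (σ : K →+* ℂ),
      (Model.picardCMUniverse exists_isReal_hodgeModel_holds hodgePQ_independent_of_hodgeModel_holds
        BallQuotient.ballQuotientUniformised_holds cmAbelianVarietyRealised_holds).PeriodNV ι₁ V K R₁.psi σ)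
    (h₂ : ∃ ι₁ : K →+* ℂ, R₂.Admissible ι₁ ∧ ∃ (V : HermSpace3 K ι₁) (σ : K →+* ℂ),
      (Model.picardCMUniverse exists_isReal_hodgeModel_holds hodgePQ_independent_of_hodgeModel_holds
        BallQuotient.ballQuotientUniformised_holds cmAbelianVarietyRealised_holds).PeriodNV ι₁ V K R₂.psi σ)
    {P A : AbelianVariety ℂ} (hP : AbelianVariety.IsProductOf (fun B : AbelianVariety ℂ =>
      ∃ (E : Type) (_ : Field E) (_ : NumberField E) (_ : IsCMField E) (_ : E →+* (K : Type)) (Φ : CMType E)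
        (ι : 𝓞 E →+* End B) (θ : E →+* Module.End ℂ (complexBetti B.X 1)),
        IsCMTypeRealisation Φ B ι θ) P)
    (hA : AVDominatedBy A P) : HodgeConjectureFor A.dim A.X := by
  obtain ⟨ε, hε, hread, hidx, hεc⟩ := exists_autEnum_of_mulEquiv K e
  refine hodgeConjectureFor_of_avDominatedBy_isProductOf_of_facePeriod_octicC4C2Square_aut K σ₀ ε hε _ hconj hεc R₁ R₂
    1 (e.symm (Multiplicative.ofAdd ((1 : ZMod 4), (0 : ZMod 2)))) 1 (e.symm (Multiplicative.ofAdd ((0 : ZMod 4), (1 : ZMod 2))))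
    ?_ ?_ ?_ ?_ ?_ ?_ ?_ ?_ ?_ ?_ h₁ h₂ hP hA
  · intro h
    rw [hΦ₁, ← hread h]
    exact (mem_51_iff_enum (ε h)).symm
  · rw [hp₁, FaceCensus.comp_coe_one]
  · rw [hidx 1 0 (by rw [map_one, toAdd_one]; decide)]; decide
  · exact hq₁
  · rw [hidx _ 1 (by rw [MulEquiv.apply_symm_apply, toAdd_ofAdd]; decide)]; decide
  · intro h
    rw [hΦ₂, ← hread h]
    exact (mem_51_iff_enum (ε h)).symm
  · rw [hp₂, FaceCensus.comp_coe_one]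
  · rw [hidx 1 0 (by rw [map_one, toAdd_one]; decide)]; decide
  · exact hq₂
  · rw [hidx _ 4 (by rw [MulEquiv.apply_symm_apply, toAdd_ofAdd]; decide)]; decide

end Summit.HodgeConjecture.CorCM.OcticFaceTransport.C4C2Square

namespace Summit.HodgeConjecture.CorCM.OcticFaceTransport.C4C2Nonsquare

open Summit.HodgeConjecture.CorCM.Census.FaceSquaresModel (mem)
open Summit.HodgeConjecture.CorCM.Census.OcticFaceSquaresC4C2Nonsquare (Γ enum group_spec)

/-- **The dictionary from an isomorphism with `ZMod 4 × ZMod 2`, type `ℤ/4×ℤ/2, c not a square`.**  `K` a Galois CM field,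
`e : Gal(K/ℚ) ≃* Multiplicative (ZMod 4 × ZMod 2)` such that `e⁻¹(0,1)` induces complex conjugation at `σ₀` (the NON-SQUARE class; such an `e` exists whenever `e₀⁻¹(2,0)` is not complex conjugation, `FaceCensus.conj_dichotomy_of_mulEquiv_zmod_four_two` §4).  Then there is an enumeration `ε : Aut(K) ≃ Fin 8`,
multiplicative for seat b30's Cayley table, reading `e` through b30's additive `enum` (`enum (ε h) = toAdd (e h)`), with
`ε (e⁻¹ conj-element) = Γ.conj`. [folklore] -/
theorem exists_autEnum_of_mulEquiv (K : CMField) [IsGalois ℚ K] (e : ((K : Type) ≃ₐ[ℚ] (K : Type)) ≃* Multiplicative (ZMod 4 × ZMod 2)) :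
    ∃ ε : ((K : Type) ≃ₐ[ℚ] (K : Type)) ≃ Fin 8,
      (∀ x y : ((K : Type) ≃ₐ[ℚ] (K : Type)), ε (x * y) = Γ.mul (ε x) (ε y)) ∧ (∀ h : ((K : Type) ≃ₐ[ℚ] (K : Type)), enum (ε h) = Multiplicative.toAdd (e h)) ∧
      (∀ (h : ((K : Type) ≃ₐ[ℚ] (K : Type))) (i : Fin 8), Multiplicative.toAdd (e h) = enum i → ε h = i) ∧
      ε (e.symm (Multiplicative.ofAdd ((0 : ZMod 4), (1 : ZMod 2)))) = Γ.conj := by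
  obtain ⟨ε, hε, hread⟩ := FaceCensus.exists_enum_of_groupEnum Γ (· + ·) enum group_spec.2.1 group_spec.2.2.1
    (by simp) (fun h => Multiplicative.toAdd (e h)) (Multiplicative.toAdd.bijective.comp e.bijective)
    (fun x y => by rw [map_mul, toAdd_mul])
  refine ⟨ε, hε, hread, fun h i hh => group_spec.2.2.1 ((hread h).trans hh), group_spec.2.2.1 ?_⟩
  rw [hread, MulEquiv.apply_symm_apply, toAdd_ofAdd, group_spec.2.2.2]

/-- The common base type of the generating representatives, code `15`, read in `ZMod 4 × ZMod 2`. [folklore] -/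
theorem mem_15_iff_enum : ∀ i : Fin 8, mem i 15 = true ↔ enum i ∈ ({((0 : ZMod 4), (0 : ZMod 2)), ((1 : ZMod 4), (0 : ZMod 2)), ((2 : ZMod 4), (0 : ZMod 2)), ((3 : ZMod 4), (0 : ZMod 2))} : Finset (ZMod 4 × ZMod 2)) := by
  decide

/-- **Non-vacuity, type `ℤ/4×ℤ/2, c not a square`, face 1.**  For `K`, `e`, `σ₀` as in the closing theorem there is a rank-four face
`(Φ₀; σ₀, σ₀ ∘ e⁻¹(1,0))`: base type `Φ₀` with `σ₀ ∘ h ∈ Φ₀ ↔ e h ∈ {(0,0),(1,0),(2,0),(3,0)}`, place representatives `σ₀` and `σ₀ ∘ e⁻¹((1), (0))`.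
[folklore] -/
theorem exists_face₁_of_mulEquiv (K : CMField) [IsGalois ℚ K] (e : ((K : Type) ≃ₐ[ℚ] (K : Type)) ≃* Multiplicative (ZMod 4 × ZMod 2)) (σ₀ : (K : Type) →+* ℂ)
    (hconj : σ₀.comp ((e.symm (Multiplicative.ofAdd ((0 : ZMod 4), (1 : ZMod 2))) : ((K : Type) ≃ₐ[ℚ] (K : Type))) : (K : Type) →+* (K : Type)) = conjugate σ₀) :
    ∃ R : Face K, (∀ h : ((K : Type) ≃ₐ[ℚ] (K : Type)), σ₀.comp (h : (K : Type) →+* (K : Type)) ∈ R.Φ.1 ↔ Multiplicative.toAdd (e h) ∈ ({((0 : ZMod 4), (0 : ZMod 2)), ((1 : ZMod 4), (0 : ZMod 2)), ((2 : ZMod 4), (0 : ZMod 2)), ((3 : ZMod 4), (0 : ZMod 2))} : Finset (ZMod 4 × ZMod 2))) ∧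
      R.p = σ₀ ∧ R.p' = σ₀.comp ((e.symm (Multiplicative.ofAdd ((1 : ZMod 4), (0 : ZMod 2))) : ((K : Type) ≃ₐ[ℚ] (K : Type))) : (K : Type) →+* (K : Type)) := by
  obtain ⟨ε, hε, hread, hidx, hεc⟩ := exists_autEnum_of_mulEquiv K e
  obtain ⟨e', hmul, he⟩ := FaceCensus.exists_enum_of_autEnum Γ σ₀ ε hε
  have hconj' : e' conjT = Γ.conj := by rw [FaceCensus.conjT_eq_translate σ₀, ← hconj, he, hεc]
  obtain ⟨R₀, hT₀, -, -⟩ := FaceCensus.exists_face_reads Γ e' hmul hconj' σ₀ (r := (15, 17, 34)) (by decide +kernel)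
  have hq : ε (e.symm (Multiplicative.ofAdd ((1 : ZMod 4), (0 : ZMod 2)))) = 1 :=
    hidx _ _ (by rw [MulEquiv.apply_symm_apply, toAdd_ofAdd]; decide)
  have h1 : ε 1 = 0 := hidx _ _ (by rw [map_one, toAdd_one]; decide)
  have hne' : InfinitePlace.mk (σ₀.comp ((1 : ((K : Type) ≃ₐ[ℚ] (K : Type))) : (K : Type) →+* (K : Type))) ≠
      InfinitePlace.mk (σ₀.comp ((e.symm (Multiplicative.ofAdd ((1 : ZMod 4), (0 : ZMod 2))) : ((K : Type) ≃ₐ[ℚ] (K : Type))) : (K : Type) →+* (K : Type))) := by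
    rw [Ne, FaceCensus.mk_comp_eq_mk_comp_iff σ₀ hconj]
    rintro (h | h)
    · have := congrArg ε h; rw [h1, hq] at this; exact absurd this (by decide)
    · have := congrArg ε h; rw [mul_one, hεc, hq] at this; exact absurd this (by decide)
  have hne : InfinitePlace.mk σ₀ ≠ InfinitePlace.mk (σ₀.comp ((e.symm (Multiplicative.ofAdd ((1 : ZMod 4), (0 : ZMod 2))) : ((K : Type) ≃ₐ[ℚ] (K : Type))) : (K : Type) →+* (K : Type))) := by
    rwa [FaceCensus.comp_coe_one] at hne'
  refine ⟨⟨R₀.Φ, _, _, hne⟩, fun h => ?_, rfl, rfl⟩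
  have hk := hT₀.2 (e' (translate σ₀ (σ₀.comp (h : (K : Type) →+* (K : Type)))))
  rw [e'.symm_apply_apply, mem_pullType, translate_apply_self, he] at hk
  rw [← hread h]
  exact hk.symm.trans (mem_15_iff_enum (ε h))

/-- **Non-vacuity, type `ℤ/4×ℤ/2, c not a square`, face 2.**  For `K`, `e`, `σ₀` as in the closing theorem there is a rank-four face
`(Φ₀; σ₀, σ₀ ∘ e⁻¹(2,0))`: base type `Φ₀` with `σ₀ ∘ h ∈ Φ₀ ↔ e h ∈ {(0,0),(1,0),(2,0),(3,0)}`, place representatives `σ₀` and `σ₀ ∘ e⁻¹((2), (0))`.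
[folklore] -/
theorem exists_face₂_of_mulEquiv (K : CMField) [IsGalois ℚ K] (e : ((K : Type) ≃ₐ[ℚ] (K : Type)) ≃* Multiplicative (ZMod 4 × ZMod 2)) (σ₀ : (K : Type) →+* ℂ)
    (hconj : σ₀.comp ((e.symm (Multiplicative.ofAdd ((0 : ZMod 4), (1 : ZMod 2))) : ((K : Type) ≃ₐ[ℚ] (K : Type))) : (K : Type) →+* (K : Type)) = conjugate σ₀) :
    ∃ R : Face K, (∀ h : ((K : Type) ≃ₐ[ℚ] (K : Type)), σ₀.comp (h : (K : Type) →+* (K : Type)) ∈ R.Φ.1 ↔ Multiplicative.toAdd (e h) ∈ ({((0 : ZMod 4), (0 : ZMod 2)), ((1 : ZMod 4), (0 : ZMod 2)), ((2 : ZMod 4), (0 : ZMod 2)), ((3 : ZMod 4), (0 : ZMod 2))} : Finset (ZMod 4 × ZMod 2))) ∧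
      R.p = σ₀ ∧ R.p' = σ₀.comp ((e.symm (Multiplicative.ofAdd ((2 : ZMod 4), (0 : ZMod 2))) : ((K : Type) ≃ₐ[ℚ] (K : Type))) : (K : Type) →+* (K : Type)) := by
  obtain ⟨ε, hε, hread, hidx, hεc⟩ := exists_autEnum_of_mulEquiv K e
  obtain ⟨e', hmul, he⟩ := FaceCensus.exists_enum_of_autEnum Γ σ₀ ε hε
  have hconj' : e' conjT = Γ.conj := by rw [FaceCensus.conjT_eq_translate σ₀, ← hconj, he, hεc]
  obtain ⟨R₀, hT₀, -, -⟩ := FaceCensus.exists_face_reads Γ e' hmul hconj' σ₀ (r := (15, 17, 68)) (by decide +kernel)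
  have hq : ε (e.symm (Multiplicative.ofAdd ((2 : ZMod 4), (0 : ZMod 2)))) = 2 :=
    hidx _ _ (by rw [MulEquiv.apply_symm_apply, toAdd_ofAdd]; decide)
  have h1 : ε 1 = 0 := hidx _ _ (by rw [map_one, toAdd_one]; decide)
  have hne' : InfinitePlace.mk (σ₀.comp ((1 : ((K : Type) ≃ₐ[ℚ] (K : Type))) : (K : Type) →+* (K : Type))) ≠
      InfinitePlace.mk (σ₀.comp ((e.symm (Multiplicative.ofAdd ((2 : ZMod 4), (0 : ZMod 2))) : ((K : Type) ≃ₐ[ℚ] (K : Type))) : (K : Type) →+* (K : Type))) := by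
    rw [Ne, FaceCensus.mk_comp_eq_mk_comp_iff σ₀ hconj]
    rintro (h | h)
    · have := congrArg ε h; rw [h1, hq] at this; exact absurd this (by decide)
    · have := congrArg ε h; rw [mul_one, hεc, hq] at this; exact absurd this (by decide)
  have hne : InfinitePlace.mk σ₀ ≠ InfinitePlace.mk (σ₀.comp ((e.symm (Multiplicative.ofAdd ((2 : ZMod 4), (0 : ZMod 2))) : ((K : Type) ≃ₐ[ℚ] (K : Type))) : (K : Type) →+* (K : Type))) := by
    rwa [FaceCensus.comp_coe_one] at hne'
  refine ⟨⟨R₀.Φ, _, _, hne⟩, fun h => ?_, rfl, rfl⟩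
  have hk := hT₀.2 (e' (translate σ₀ (σ₀.comp (h : (K : Type) →+* (K : Type)))))
  rw [e'.symm_apply_apply, mem_pullType, translate_apply_self, he] at hk
  rw [← hread h]
  exact hk.symm.trans (mem_15_iff_enum (ε h))

/-- **FIELD CLOSURE FROM `Gal(K/ℚ) ≃* Multiplicative (ZMod 4 × ZMod 2)`, type `ℤ/4×ℤ/2, c not a square` — CLOSED, headline.**  `K` a Galois CM
field with an isomorphism `e : Gal(K/ℚ) ≃* Multiplicative (ZMod 4 × ZMod 2)` (so `[K:ℚ] = 8`) under which `e⁻¹(0,1)` induces complex conjugation at `σ₀` (the NON-SQUARE class; such an `e` exists whenever `e₀⁻¹(2,0)` is not complex conjugation, `FaceCensus.conj_dichotomy_of_mulEquiv_zmod_four_two` §4); `σ₀` a base embedding;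
`Φ₀` the CM type with `σ₀ ∘ h ∈ Φ₀ ↔ e h ∈ {(0,0),(1,0),(2,0),(3,0)}`; the TWO faces `R₁ = (Φ₀; σ₀, σ₀ ∘ e⁻¹(1,0))`, `R₂ = (Φ₀; σ₀, σ₀ ∘ e⁻¹(2,0))`
(they exist: `exists_face₁_of_mulEquiv`, `exists_face₂_of_mulEquiv`).  ONE period witness for each on the universe of record implies the Hodge conjecture, in every
codimension, for every complex abelian variety dominated by a finite product of abelian varieties realising CM types of CM fields
embeddable in `K`.  No enumeration or table hypothesis is left (`exists_autEnum_of_mulEquiv`).  (FRAMING: conditional on these face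
periods; `HC_CM` is NOT proved.) [cite: Shimura1998, §6.2 Theorem 3 and §6.1 Corollary of Theorem 2 (pp. 41–43)]
[cite: Pohlmann1968, Thm. 1] [cite: Milne1999LefschetzClasses, Thm. 3.2 and Cor. 4.5] [cite: MumfordAV1970, §19 Thm. 1 and p. 169] -/
theorem hodgeConjectureFor_of_avDominatedBy_isProductOf_of_facePeriod_octicC4C2Nonsquare_mulEquiv (K : CMField) [IsGalois ℚ K]
    (e : ((K : Type) ≃ₐ[ℚ] (K : Type)) ≃* Multiplicative (ZMod 4 × ZMod 2)) (σ₀ : (K : Type) →+* ℂ)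
    (hconj : σ₀.comp ((e.symm (Multiplicative.ofAdd ((0 : ZMod 4), (1 : ZMod 2))) : ((K : Type) ≃ₐ[ℚ] (K : Type))) : (K : Type) →+* (K : Type)) = conjugate σ₀)
    (R₁ R₂ : Face K)
    (hΦ₁ : ∀ h : ((K : Type) ≃ₐ[ℚ] (K : Type)), σ₀.comp (h : (K : Type) →+* (K : Type)) ∈ R₁.Φ.1 ↔ Multiplicative.toAdd (e h) ∈ ({((0 : ZMod 4), (0 : ZMod 2)), ((1 : ZMod 4), (0 : ZMod 2)), ((2 : ZMod 4), (0 : ZMod 2)), ((3 : ZMod 4), (0 : ZMod 2))} : Finset (ZMod 4 × ZMod 2)))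
    (hp₁ : R₁.p = σ₀) (hq₁ : R₁.p' = σ₀.comp ((e.symm (Multiplicative.ofAdd ((1 : ZMod 4), (0 : ZMod 2))) : ((K : Type) ≃ₐ[ℚ] (K : Type))) : (K : Type) →+* (K : Type)))
    (hΦ₂ : ∀ h : ((K : Type) ≃ₐ[ℚ] (K : Type)), σ₀.comp (h : (K : Type) →+* (K : Type)) ∈ R₂.Φ.1 ↔ Multiplicative.toAdd (e h) ∈ ({((0 : ZMod 4), (0 : ZMod 2)), ((1 : ZMod 4), (0 : ZMod 2)), ((2 : ZMod 4), (0 : ZMod 2)), ((3 : ZMod 4), (0 : ZMod 2))} : Finset (ZMod 4 × ZMod 2)))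
    (hp₂ : R₂.p = σ₀) (hq₂ : R₂.p' = σ₀.comp ((e.symm (Multiplicative.ofAdd ((2 : ZMod 4), (0 : ZMod 2))) : ((K : Type) ≃ₐ[ℚ] (K : Type))) : (K : Type) →+* (K : Type)))
    (h₁ : ∃ ι₁ : K →+* ℂ, R₁.Admissible ι₁ ∧ ∃ (V : HermSpace3 K ι₁) (σ : K →+* ℂ),
      (Model.picardCMUniverse exists_isReal_hodgeModel_holds hodgePQ_independent_of_hodgeModel_holds
        BallQuotient.ballQuotientUniformised_holds cmAbelianVarietyRealised_holds).PeriodNV ι₁ V K R₁.psi σ)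
    (h₂ : ∃ ι₁ : K →+* ℂ, R₂.Admissible ι₁ ∧ ∃ (V : HermSpace3 K ι₁) (σ : K →+* ℂ),
      (Model.picardCMUniverse exists_isReal_hodgeModel_holds hodgePQ_independent_of_hodgeModel_holds
        BallQuotient.ballQuotientUniformised_holds cmAbelianVarietyRealised_holds).PeriodNV ι₁ V K R₂.psi σ)
    {P A : AbelianVariety ℂ} (hP : AbelianVariety.IsProductOf (fun B : AbelianVariety ℂ =>
      ∃ (E : Type) (_ : Field E) (_ : NumberField E) (_ : IsCMField E) (_ : E →+* (K : Type)) (Φ : CMType E)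
        (ι : 𝓞 E →+* End B) (θ : E →+* Module.End ℂ (complexBetti B.X 1)),
        IsCMTypeRealisation Φ B ι θ) P)
    (hA : AVDominatedBy A P) : HodgeConjectureFor A.dim A.X := by
  obtain ⟨ε, hε, hread, hidx, hεc⟩ := exists_autEnum_of_mulEquiv K e
  refine hodgeConjectureFor_of_avDominatedBy_isProductOf_of_facePeriod_octicC4C2Nonsquare_aut K σ₀ ε hε _ hconj hεc R₁ R₂
    1 (e.symm (Multiplicative.ofAdd ((1 : ZMod 4), (0 : ZMod 2)))) 1 (e.symm (Multiplicative.ofAdd ((2 : ZMod 4), (0 : ZMod 2))))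
    ?_ ?_ ?_ ?_ ?_ ?_ ?_ ?_ ?_ ?_ h₁ h₂ hP hA
  · intro h
    rw [hΦ₁, ← hread h]
    exact (mem_15_iff_enum (ε h)).symm
  · rw [hp₁, FaceCensus.comp_coe_one]
  · rw [hidx 1 0 (by rw [map_one, toAdd_one]; decide)]; decide
  · exact hq₁
  · rw [hidx _ 1 (by rw [MulEquiv.apply_symm_apply, toAdd_ofAdd]; decide)]; decide
  · intro h
    rw [hΦ₂, ← hread h]
    exact (mem_15_iff_enum (ε h)).symm
  · rw [hp₂, FaceCensus.comp_coe_one]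
  · rw [hidx 1 0 (by rw [map_one, toAdd_one]; decide)]; decide
  · exact hq₂
  · rw [hidx _ 2 (by rw [MulEquiv.apply_symm_apply, toAdd_ofAdd]; decide)]; decide

end Summit.HodgeConjecture.CorCM.OcticFaceTransport.C4C2Nonsquare

/-! ## §4 Normalising a given isomorphism: where complex conjugation sits -/

namespace Summit.HodgeConjecture.CorCM.FaceCensus

/-- A multiplicative-to-`Multiplicative` bijection re-bundled as a `MulEquiv` (used to re-normalise a given isomorphism by an
additive automorphism of the target). [folklore] -/
theorem exists_mulEquiv_of_bijective {A : Type*} [Group A] {V : Type*} [AddCommGroup V] (f : A → V)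
    (hf : Function.Bijective f) (hmul : ∀ x y, f (x * y) = f x + f y) :
    ∃ e : A ≃* Multiplicative V, ∀ x, Multiplicative.toAdd (e x) = f x := by
  refine ⟨MulEquiv.ofBijective (MonoidHom.mk' (fun x => Multiplicative.ofAdd (f x))
    (fun x y => by rw [hmul, ofAdd_add])) (Multiplicative.ofAdd.bijective.comp hf), fun x => ?_⟩
  rfl

variable (K : CMField) [IsGalois ℚ K] (σ₀ : (K : Type) →+* ℂ)

/-- **Conjugation dichotomy for `Gal(K/ℚ) ≃* ℤ/4×ℤ/2`.**  For ANY isomorphism `e₀ : Gal(K/ℚ) ≃* Multiplicative (ZMod 4 × ZMod 2)` of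
a Galois CM field: either `e₀⁻¹(2,0)` induces complex conjugation at `σ₀` (square class — the hypothesis of
`OcticFaceTransport.C4C2Square.…_mulEquiv`), or there is an isomorphism `e` with `e⁻¹(0,1)` inducing complex conjugation (non-square
class — the hypothesis of `OcticFaceTransport.C4C2Nonsquare.…_mulEquiv`): complex conjugation is an involution `≠ 1`, the involutions
of `ℤ/4×ℤ/2` are `(2,0), (0,1), (2,1)`, and `(a,b) ↦ (a+2b, b)` exchanges the last two (`FaceCensus.zmod_four_two_involution`,
`FaceCensus.zmod_four_two_normalise`). [folklore] -/
theorem conj_dichotomy_of_mulEquiv_zmod_four_two (e₀ : ((K : Type) ≃ₐ[ℚ] (K : Type)) ≃* Multiplicative (ZMod 4 × ZMod 2)) :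
    σ₀.comp ((e₀.symm (Multiplicative.ofAdd ((2 : ZMod 4), (0 : ZMod 2))) : ((K : Type) ≃ₐ[ℚ] (K : Type))) : (K : Type) →+* (K : Type)) = conjugate σ₀ ∨
      ∃ e : ((K : Type) ≃ₐ[ℚ] (K : Type)) ≃* Multiplicative (ZMod 4 × ZMod 2),
        σ₀.comp ((e.symm (Multiplicative.ofAdd ((0 : ZMod 4), (1 : ZMod 2))) : ((K : Type) ≃ₐ[ℚ] (K : Type))) : (K : Type) →+* (K : Type)) = conjugate σ₀ := by
  obtain ⟨c, hc⟩ := exists_conjAut σ₀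
  obtain ⟨h0, h2⟩ := involution_of_map_add (fun x => Multiplicative.toAdd (e₀ x))
    (Multiplicative.toAdd.injective.comp e₀.injective) (fun x y => by rw [map_mul, toAdd_mul])
    (conjAut_mul_self σ₀ hc) (conjAut_ne_one σ₀ hc)
  rcases zmod_four_two_involution _ h0 h2 with h | h
  · left
    rw [← h, ofAdd_toAdd, MulEquiv.symm_apply_apply]; exact hc
  · right
    obtain ⟨ψ, hψ, hψadd, hψv⟩ := zmod_four_two_normalise _ h
    obtain ⟨e, he⟩ := exists_mulEquiv_of_bijective (fun x => ψ (Multiplicative.toAdd (e₀ x)))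
      (hψ.comp (Multiplicative.toAdd.bijective.comp e₀.bijective)) (fun x y => by rw [map_mul, toAdd_mul, hψadd])
    refine ⟨e, ?_⟩
    have hec : e c = Multiplicative.ofAdd ((0 : ZMod 4), (1 : ZMod 2)) := by
      rw [← ofAdd_toAdd (e c), he]; exact congrArg _ hψv
    rw [← hec, MulEquiv.symm_apply_apply]; exact hc

/-- **Normalisation for `Gal(K/ℚ) ≃* (ℤ/2)³`.**  For ANY isomorphism `e₀ : Gal(K/ℚ) ≃* Multiplicative (ZMod 2 × ZMod 2 × ZMod 2)` of a
Galois CM field there is one, `e`, with `e⁻¹(1,0,0)` inducing complex conjugation at `σ₀` (the hypothesis of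
`OcticFaceTransport.Triquadratic.…_mulEquiv`): complex conjugation reads a non-zero vector, carried to `(1,0,0)` by an additive bijection
(`FaceCensus.zmod_two_cube_normalise`). [folklore] -/
theorem exists_mulEquiv_conj_zmod_two_cube (e₀ : ((K : Type) ≃ₐ[ℚ] (K : Type)) ≃* Multiplicative (ZMod 2 × ZMod 2 × ZMod 2)) :
    ∃ e : ((K : Type) ≃ₐ[ℚ] (K : Type)) ≃* Multiplicative (ZMod 2 × ZMod 2 × ZMod 2),
      σ₀.comp ((e.symm (Multiplicative.ofAdd ((1 : ZMod 2), (0 : ZMod 2), (0 : ZMod 2))) : ((K : Type) ≃ₐ[ℚ] (K : Type))) : (K : Type) →+* (K : Type)) = conjugate σ₀ := by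
  obtain ⟨c, hc⟩ := exists_conjAut σ₀
  obtain ⟨h0, -⟩ := involution_of_map_add (fun x => Multiplicative.toAdd (e₀ x))
    (Multiplicative.toAdd.injective.comp e₀.injective) (fun x y => by rw [map_mul, toAdd_mul])
    (conjAut_mul_self σ₀ hc) (conjAut_ne_one σ₀ hc)
  obtain ⟨ψ, hψ, hψadd, hψv⟩ := zmod_two_cube_normalise _ h0
  obtain ⟨e, he⟩ := exists_mulEquiv_of_bijective (fun x => ψ (Multiplicative.toAdd (e₀ x)))
    (hψ.comp (Multiplicative.toAdd.bijective.comp e₀.bijective)) (fun x y => by rw [map_mul, toAdd_mul, hψadd])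
  refine ⟨e, ?_⟩
  have hec : e c = Multiplicative.ofAdd ((1 : ZMod 2), (0 : ZMod 2), (0 : ZMod 2)) := by
    rw [← ofAdd_toAdd (e c), he]; exact congrArg _ hψv
  rw [← hec, MulEquiv.symm_apply_apply]; exact hc

end Summit.HodgeConjecture.CorCM.FaceCensus

end
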